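import Summits.HodgeConjecture.HodgeConjecture.Theses.NoetherLefschetzOneUp
import Summits.HodgeConjecture.HodgeConjecture.Theorems.NoetherLefschetzOneUpMiddleReduction
import Summits.HodgeConjecture.HodgeConjecture.Theorems.NoetherLefschetzOneUpNetReduction
import Summits.HodgeConjecture.HodgeConjecture.Theorems.NoetherLefschetzOneUpSummitGrantedFourfoldsStubHodgeBelowLevel
import Summits.HodgeConjecture.HodgeConjecture.Theorems.NoetherLefschetzOneUpSummitGrantedFourfoldsStubVerticalOfBelow
import HarnessLib

/-!
# Route NoetherLefschetzOneUp — the crux `SummitGrantedFourfolds` (stmt-HodgeConjecture-14600) is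
# EQUIVALENT to its two NET pieces; the vertical piece is a theorem

The crux `SummitGrantedFourfolds` (rank 4) of route
`Summits/HodgeConjecture/HodgeConjecture/Theses/NoetherLefschetzOneUp` is
`HC(4;2,2) → ∀ n X, IsSmoothProjective n X → Nonempty (HodgeModel n X) ∧ (every rational (p,p)-class on
X is algebraic)` — "the summit granted the fourfold middle degree" (`≡ HC(4;2,2) → HodgeConjecture`).
Its open content is the middle degree `(m,m)` of smooth projective `2m`-folds for `m ≥ 3` (the floor
`m ≤ 2` being `algebraicClasses_zero`, Lefschetz `(1,1)` and the hypothesis, and everything off the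
middle being BFNP Lemma 48, `Theorems.middleReduction_proof`).

The crux-strategist cut that content (Cruxes/SummitGrantedFourfolds/STRATEGY-CENSUS.md §1, line
`Lines/netRegimeSplit.lean`) as NET × REGIME: every smooth projective `2m`-fold is reached, up to a
birational blow-down, by the total space of a net of `(2m-2)`-folds over `ℙ²` (a THEOREM of the tree,
`Motives.exists_fiberNet_smoothBase_nonempty_holds`, with `Theorems.isBirational_blowDown` and
`mem_algebraicClasses_of_isBirational`), and on a `2m`-fold `X` with a surjective `f : X ⟶ ℙ²` a
rational `(m,m)`-class is read modulo the VERTICAL classes (those dying on `(X ∖ f⁻¹T)(ℂ)` for a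
Zariski-closed `T ⊊ ℙ²`). The three pieces, written out below as hypotheses (they are not route decls):

* `P1 = SixfoldNetClasses`: `HC(4;2,2) →` on every smooth projective sixfold surjecting onto `ℙ²`, the
  span of the rational `(3,3)`-classes lies in `algebraicClasses X 3 ⊔ (vertical span)` — OPEN (it is
  `HC(6;3,3)` modulo coniveau-1 classes; general Weil-type abelian sixfolds);
* `P2 = HigherNetClasses`: the same at every level `m ≥ 4`, granted all middle levels `< m` — OPEN
  (the declared open boundary of the route, in ladder form);
* `P3 = HigherVerticalClasses`: at every level `m ≥ 3`, granted all middle levels `< m`, the vertical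
  span lies in `algebraicClasses X m`.

This file PROVES `P3` outright — `higherVerticalClasses`, from the two landed stubs of the lead's
reshaped line `birth` (v2): `stub_hodgeBelowLevel` (the Hodge conjecture in every dimension `< 2m`
granted the middle levels `< m`: pencil step below the middle, de Cataldo–Migliorini 2009 §4 /
Thomas 2005 §2, + hard Lefschetz) and `stub_verticalOfBelow` (Deligne, Hodge III Cor. 8.2.8 + the
semisimple lift, Voisin 2025 Cor. 2.12 + projective Hironaka + Gysin images of algebraic classes are
algebraic — Voisin 2013, proof of Lemma 2.1) — and records the consequences for the crux:

* `summitGrantedFourfolds_of_netClasses : P1 → P2 → SummitGrantedFourfolds` — the glue of the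
  strategist's split with its third child DISCHARGED (so the split needs only the two crux children);
* `summitGrantedFourfolds_of_pieces : P1 → P2 → P3 → SummitGrantedFourfolds` — the glue in the exact
  three-child shape of the staged `children.json` (its third hypothesis is now idle);
* `sixfoldNetClasses_of_summitGrantedFourfolds`, `higherNetClasses_of_summitGrantedFourfolds` and
  `summitGrantedFourfolds_iff_netClasses : SummitGrantedFourfolds ↔ P1 ∧ P2` — the cut is LOSSLESS:
  the two open net pieces are jointly equivalent to the crux (pure logic for the converse: the ladder
  hypothesis of `P2` at `m ≥ 4` contains level `2 = HC(4;2,2)`, and the crux turns `HC(4;2,2)` into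
  the whole Hodge conjecture);
* `sixfoldsGrantedFourfolds_of_sixfoldNetClasses`, `ladderFromEightfolds_of_higherNetClasses` — the
  two stubs of the REGISTERED birth skeleton (rung `3 | 2`, rungs `≥ 4 | below`, sha a8ff086b…) now
  follow from the corresponding net piece ALONE.

Everything here is sorry-free and uses no named fact (axioms `propext`, `Classical.choice`,
`Quot.sound`); what remains open of the crux is exactly `P1 ∧ P2`.

## References

* [BrosnanFangNiePearlstein2009] P. Brosnan, H. Fang, Z. Nie, G. Pearlstein, Invent. Math. 177
  (2009), §6 Lemma 48.
* [DeligneHodgeIII1974] P. Deligne, *Théorie de Hodge III*, Publ. Math. IHÉS 44 (1974), Cor. 8.2.8.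
* [Voisin2013GHCBloch] C. Voisin, Ann. Sci. ÉNS 46 (2013), Lemma 2.1 (proof).
* [Voisin2025] C. Voisin, J. Open Math. Probl. 1 (2025), Cor. 2.12.
* [DecataldoMigliorini2009] M. A. de Cataldo, L. Migliorini, §4 Prop. 4.5.
* [Arapura2022] D. Arapura, §1 (nets over a surface base).
* [Deligne2000] P. Deligne, *The Hodge conjecture*, Clay (2000), §1.
-/

-- `Summit.HodgeConjecture.HodgeConjecture.Theorems` is the mandated namespace (single-problem summit),
-- flagged by `linter.dupNamespace`; the lakefile turns the linter off tree-wide, restated here.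
set_option linter.dupNamespace false

noncomputable section

open CategoryTheory AlgebraicGeometry
open Literature.AlgebraicGeometry Literature.AlgebraicGeometry.Motives
open Literature.AlgebraicGeometry.HodgeTheory
open Summit.HodgeConjecture.HodgeConjecture.Theses.NoetherLefschetzOneUp

namespace Summit.HodgeConjecture.HodgeConjecture.Theorems

/-- **The vertical piece `HigherVerticalClasses` is a THEOREM**: for every level `m ≥ 3`, if every
rational `(m',m')`-class on every smooth projective complex `2m'`-fold is algebraic for all `m' < m`,
then for `X` smooth projective of dimension `2m` over `ℂ` and `f : X ⟶ ℙ²` surjective on points, the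
span of the rational `(m,m)`-classes dying on `(X ∖ f⁻¹T)(ℂ)` for some Zariski-closed `T ⊊ ℙ²` lies in
`algebraicClasses X m`. Proof: the lower levels give the Hodge conjecture in every dimension `< 2m`
(`stub_hodgeBelowLevel`: pencil step below the middle + the granted levels + hard Lefschetz — BFNP
Lemma 48 truncated), which feeds the descent of vertical classes (`stub_verticalOfBelow`: Deligne
8.2.8 + semisimple lift + Hironaka + Gysin images of algebraic classes). The hypothesis `3 ≤ m` is not
used (the statement holds at every level). Statement verbatim the strategist's piece
(`Cruxes/SummitGrantedFourfolds/Lines/netRegimeSplit.lean`, `stub_higherVerticalClasses`).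
[cite: DeligneHodgeIII1974, Cor. 8.2.8] [cite: Voisin2025, Cor. 2.12]
[cite: Voisin2013GHCBloch, Lemma 2.1 (proof)] [cite: BrosnanFangNiePearlstein2009, §6 Lemma 48]
[cite: DecataldoMigliorini2009, §4 Prop. 4.5] -/
theorem higherVerticalClasses :
    ∀ ⦃m : ℕ⦄, 3 ≤ m → (∀ m' : ℕ, m' < m → ∀ ⦃X : Literature.AlgebraicGeometry.Motives.SchemeOver ℂ⦄, Literature.AlgebraicGeometry.Motives.IsSmoothProjective (2 * m') X → ∀ c : Literature.AlgebraicGeometry.HodgeTheory.complexBetti X (2 * m'), Literature.AlgebraicGeometry.HodgeTheory.IsRationalClass c → Literature.AlgebraicGeometry.HodgeTheory.IsOfHodgeType (2 * m') X (2 * m') m' m' c → c ∈ Literature.AlgebraicGeometry.HodgeTheory.algebraicClasses X m') → ∀ ⦃X : Literature.AlgebraicGeometry.Motives.SchemeOver ℂ⦄ (f : X ⟶ Literature.AlgebraicGeometry.Motives.projectiveSpace 2 ℂ), Literature.AlgebraicGeometry.Motives.IsSmoothProjective (2 * m) X → Function.Surjective f.left.base → Submodule.span ℂ {c : Literature.AlgebraicGeometry.HodgeTheory.complexBetti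 X (2 * m) | Literature.AlgebraicGeometry.HodgeTheory.IsRationalClass c ∧ Literature.AlgebraicGeometry.HodgeTheory.IsOfHodgeType (2 * m) X (2 * m) m m c ∧ ∃ T : Set (Literature.AlgebraicGeometry.Motives.projectiveSpace 2 ℂ).left, IsClosed T ∧ T ≠ Set.univ ∧ Literature.AlgebraicGeometry.HodgeTheory.complexBetti.restrictCompl X (f.left.base ⁻¹' T) (2 * m) c = 0} ≤ Literature.AlgebraicGeometry.HodgeTheory.algebraicClasses X m :=
  fun _ _ ih _ f hX hf ↦ stub_verticalOfBelow (stub_hodgeBelowLevel ih) f hX hf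

/-- **The crux from its two NET pieces** (`P1 = SixfoldNetClasses`, `P2 = HigherNetClasses`; the glue
of the strategist's net × regime split with its vertical child discharged by `higherVerticalClasses`):
strong induction on the level `m` of the middle degree — floor `m = 0` (`algebraicClasses_zero`),
`m = 1` (`LefschetzOneOne_holds`), `m = 2` (the crux's hypothesis HC(4;2,2)); at `m ≥ 3` a net of
`(2m-2)`-folds over `ℙ²` on the `2m`-fold (`exists_fiberNet_smoothBase_nonempty_holds`), on whose total
space a rational `(m,m)`-class lies in `algebraicClasses ⊔ vertical` by the net piece of the level
(`P1` fed with HC(4;2,2) at `m = 3`, `P2` fed with all lower levels at `m ≥ 4`) and the vertical span is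
algebraic (`higherVerticalClasses`), followed by birational descent along the blow-down
(`isBirational_blowDown`, `mem_algebraicClasses_of_isBirational`); then BFNP Lemma 48
(`middleReduction_proof`) for the degrees off the middle and `HodgeModels_holds` for the first conjunct.
[cite: BrosnanFangNiePearlstein2009, §6 Lemma 48] [cite: Arapura2022, §1] [cite: Deligne2000, §1] -/
theorem summitGrantedFourfolds_of_netClasses
    (h6 : (∀ ⦃X : SchemeOver ℂ⦄, IsSmoothProjective 4 X → ∀ c : complexBetti X (2 * 2),
        IsRationalClass c → IsOfHodgeType 4 X (2 * 2) 2 2 c → c ∈ algebraicClasses X 2) →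
      ∀ ⦃X : SchemeOver ℂ⦄ (f : X ⟶ projectiveSpace 2 ℂ), IsSmoothProjective 6 X →
        Function.Surjective f.left.base →
        Submodule.span ℂ {c : complexBetti X (2 * 3) | IsRationalClass c ∧ IsOfHodgeType 6 X (2 * 3) 3 3 c} ≤
          algebraicClasses X 3 ⊔ Submodule.span ℂ {c : complexBetti X (2 * 3) | IsRationalClass c ∧
            IsOfHodgeType 6 X (2 * 3) 3 3 c ∧ ∃ T : Set (projectiveSpace 2 ℂ).left, IsClosed T ∧
              T ≠ Set.univ ∧ complexBetti.restrictCompl X (f.left.base ⁻¹' T) (2 * 3) c = 0})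
    (hN : ∀ ⦃m : ℕ⦄, 4 ≤ m → (∀ m' : ℕ, m' < m → ∀ ⦃X : SchemeOver ℂ⦄, IsSmoothProjective (2 * m') X →
        ∀ c : complexBetti X (2 * m'), IsRationalClass c → IsOfHodgeType (2 * m') X (2 * m') m' m' c →
          c ∈ algebraicClasses X m') →
      ∀ ⦃X : SchemeOver ℂ⦄ (f : X ⟶ projectiveSpace 2 ℂ), IsSmoothProjective (2 * m) X →
        Function.Surjective f.left.base →
        Submodule.span ℂ {c : complexBetti X (2 * m) | IsRationalClass c ∧ IsOfHodgeType (2 * m) X (2 * m) m m c} ≤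
          algebraicClasses X m ⊔ Submodule.span ℂ {c : complexBetti X (2 * m) | IsRationalClass c ∧
            IsOfHodgeType (2 * m) X (2 * m) m m c ∧ ∃ T : Set (projectiveSpace 2 ℂ).left, IsClosed T ∧
              T ≠ Set.univ ∧ complexBetti.restrictCompl X (f.left.base ⁻¹' T) (2 * m) c = 0}) :
    Summit.HodgeConjecture.HodgeConjecture.Theses.NoetherLefschetzOneUp.SummitGrantedFourfolds := by
  unfold Summit.HodgeConjecture.HodgeConjecture.Theses.NoetherLefschetzOneUp.SummitGrantedFourfolds
  intro h42 n X hX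
  -- every middle degree, by strong induction on the level `m`
  have hmid : ∀ m : ℕ, ∀ ⦃Y : SchemeOver ℂ⦄, IsSmoothProjective (2 * m) Y →
      ∀ c : complexBetti Y (2 * m), IsRationalClass c →
        IsOfHodgeType (2 * m) Y (2 * m) m m c → c ∈ algebraicClasses Y m := by
    intro m
    induction m using Nat.strong_induction_on with
    | _ m ih =>
      obtain hm | hm := Nat.lt_or_ge m 3
      · interval_cases m
        · -- level 0: `N⁰ H⁰ = H⁰`
          intro Y _ c _ _
          rw [algebraicClasses_zero]
          exact Submodule.mem_top
        · -- level 1: Lefschetz (1,1) on surfaces (proved support item)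
          exact fun Y hY c hc hpp ↦ LefschetzOneOne_holds hY c hc hpp
        · -- level 2: the crux's hypothesis HC(4;2,2)
          exact fun Y hY c hc hpp ↦ h42 hY c hc hpp
      · -- level m ≥ 3: a net of (2m-2)-folds over ℙ², net part + vertical part on the total space,
        -- birational descent along the blow-down
        intro Y hY c hc hpp
        obtain ⟨k, rfl⟩ : ∃ k, m = k + 1 := ⟨m - 1, by omega⟩
        have e : 2 + 2 * k = 2 * (k + 1) := by ring
        have hY' : IsSmoothProjective (2 + 2 * k) Y := e ▸ hY
        obtain ⟨N, -⟩ := exists_fiberNet_smoothBase_nonempty_holds (2 * k) 2 (by omega) hY'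
        have htot : IsSmoothProjective (2 * (k + 1)) N.total := e ▸ N.isSmoothProjective_total
        refine mem_algebraicClasses_of_isBirational htot hY N.blowDown (isBirational_blowDown hY' N)
          ?_ c hc hpp
        intro c' hc' hpp'
        have hv := higherVerticalClasses hm ih N.proj htot (FiberNet.surjective_proj N)
        obtain hk | hk := Nat.lt_or_ge (k + 1) 4
        · -- level 3: the sixfold net piece, fed with HC(4;2,2)
          obtain rfl : k = 2 := by omega
          have h1 := h6 h42 N.proj htot (FiberNet.surjective_proj N)
          exact (sup_le le_rfl hv) (h1 (Submodule.subset_span ⟨hc', hpp'⟩))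
        · -- level ≥ 4: the higher net piece, fed with all lower levels
          have h1 := hN hk ih N.proj htot (FiberNet.surjective_proj N)
          exact (sup_le le_rfl hv) (h1 (Submodule.subset_span ⟨hc', hpp'⟩))
  -- conjunct 1: Hodge models (proved support item); conjunct 2: BFNP reduction (proved support item)
  exact ⟨HodgeModels_holds hX, middleReduction_proof (fun m Y hY c hc hpp ↦ hmid m hY c hc hpp) hX⟩

/-- **The glue in the three-child shape of the staged split** (`children.json` on the item:
`SixfoldNetClasses → HigherNetClasses → HigherVerticalClasses → SummitGrantedFourfolds`). The third
hypothesis is IDLE: `HigherVerticalClasses` is the theorem `higherVerticalClasses`, so the split can be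
applied with the two crux children only (`summitGrantedFourfolds_of_netClasses`).
[cite: BrosnanFangNiePearlstein2009, §6 Lemma 48] [cite: Arapura2022, §1] -/
theorem summitGrantedFourfolds_of_pieces
    (h6 : (∀ ⦃X : SchemeOver ℂ⦄, IsSmoothProjective 4 X → ∀ c : complexBetti X (2 * 2),
        IsRationalClass c → IsOfHodgeType 4 X (2 * 2) 2 2 c → c ∈ algebraicClasses X 2) →
      ∀ ⦃X : SchemeOver ℂ⦄ (f : X ⟶ projectiveSpace 2 ℂ), IsSmoothProjective 6 X →
        Function.Surjective f.left.base →
        Submodule.span ℂ {c : complexBetti X (2 * 3) | IsRationalClass c ∧ IsOfHodgeType 6 X (2 * 3) 3 3 c} ≤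
          algebraicClasses X 3 ⊔ Submodule.span ℂ {c : complexBetti X (2 * 3) | IsRationalClass c ∧
            IsOfHodgeType 6 X (2 * 3) 3 3 c ∧ ∃ T : Set (projectiveSpace 2 ℂ).left, IsClosed T ∧
              T ≠ Set.univ ∧ complexBetti.restrictCompl X (f.left.base ⁻¹' T) (2 * 3) c = 0})
    (hN : ∀ ⦃m : ℕ⦄, 4 ≤ m → (∀ m' : ℕ, m' < m → ∀ ⦃X : SchemeOver ℂ⦄, IsSmoothProjective (2 * m') X →
        ∀ c : complexBetti X (2 * m'), IsRationalClass c → IsOfHodgeType (2 * m') X (2 * m') m' m' c →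
          c ∈ algebraicClasses X m') →
      ∀ ⦃X : SchemeOver ℂ⦄ (f : X ⟶ projectiveSpace 2 ℂ), IsSmoothProjective (2 * m) X →
        Function.Surjective f.left.base →
        Submodule.span ℂ {c : complexBetti X (2 * m) | IsRationalClass c ∧ IsOfHodgeType (2 * m) X (2 * m) m m c} ≤
          algebraicClasses X m ⊔ Submodule.span ℂ {c : complexBetti X (2 * m) | IsRationalClass c ∧
            IsOfHodgeType (2 * m) X (2 * m) m m c ∧ ∃ T : Set (projectiveSpace 2 ℂ).left, IsClosed T ∧
              T ≠ Set.univ ∧ complexBetti.restrictCompl X (f.left.base ⁻¹' T) (2 * m) c = 0})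
    (_hV : ∀ ⦃m : ℕ⦄, 3 ≤ m → (∀ m' : ℕ, m' < m → ∀ ⦃X : SchemeOver ℂ⦄, IsSmoothProjective (2 * m') X →
        ∀ c : complexBetti X (2 * m'), IsRationalClass c → IsOfHodgeType (2 * m') X (2 * m') m' m' c →
          c ∈ algebraicClasses X m') →
      ∀ ⦃X : SchemeOver ℂ⦄ (f : X ⟶ projectiveSpace 2 ℂ), IsSmoothProjective (2 * m) X →
        Function.Surjective f.left.base →
        Submodule.span ℂ {c : complexBetti X (2 * m) | IsRationalClass c ∧
            IsOfHodgeType (2 * m) X (2 * m) m m c ∧ ∃ T : Set (projectiveSpace 2 ℂ).left,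
              IsClosed T ∧ T ≠ Set.univ ∧ complexBetti.restrictCompl X (f.left.base ⁻¹' T) (2 * m) c = 0} ≤
          algebraicClasses X m) :
    Summit.HodgeConjecture.HodgeConjecture.Theses.NoetherLefschetzOneUp.SummitGrantedFourfolds :=
  summitGrantedFourfolds_of_netClasses h6 hN

/-- **The crux gives the sixfold net piece `P1`** (pure logic: under HC(4;2,2) the crux is the whole
Hodge conjecture, so every rational `(3,3)`-class on a sixfold is algebraic, a fortiori in
`algebraicClasses ⊔ vertical`). [cite: Deligne2000, §1] -/
theorem sixfoldNetClasses_of_summitGrantedFourfolds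
    (hS : Summit.HodgeConjecture.HodgeConjecture.Theses.NoetherLefschetzOneUp.SummitGrantedFourfolds) :
    (∀ ⦃X : SchemeOver ℂ⦄, IsSmoothProjective 4 X → ∀ c : complexBetti X (2 * 2),
        IsRationalClass c → IsOfHodgeType 4 X (2 * 2) 2 2 c → c ∈ algebraicClasses X 2) →
      ∀ ⦃X : SchemeOver ℂ⦄ (f : X ⟶ projectiveSpace 2 ℂ), IsSmoothProjective 6 X →
        Function.Surjective f.left.base →
        Submodule.span ℂ {c : complexBetti X (2 * 3) | IsRationalClass c ∧ IsOfHodgeType 6 X (2 * 3) 3 3 c} ≤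
          algebraicClasses X 3 ⊔ Submodule.span ℂ {c : complexBetti X (2 * 3) | IsRationalClass c ∧
            IsOfHodgeType 6 X (2 * 3) 3 3 c ∧ ∃ T : Set (projectiveSpace 2 ℂ).left, IsClosed T ∧
              T ≠ Set.univ ∧ complexBetti.restrictCompl X (f.left.base ⁻¹' T) (2 * 3) c = 0} := by
  intro h42 X f hX _
  refine le_sup_of_le_left (Submodule.span_le.mpr ?_)
  rintro c ⟨hc, hpp⟩
  exact (hS h42 hX).2 3 c hc hpp

/-- **The crux gives the higher net piece `P2`** (pure logic: at `m ≥ 4` the ladder hypothesis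
contains level `2`, which is HC(4;2,2) verbatim, and the crux turns it into the whole Hodge
conjecture, so every rational `(m,m)`-class on a `2m`-fold is algebraic). [cite: Deligne2000, §1] -/
theorem higherNetClasses_of_summitGrantedFourfolds
    (hS : Summit.HodgeConjecture.HodgeConjecture.Theses.NoetherLefschetzOneUp.SummitGrantedFourfolds) :
    ∀ ⦃m : ℕ⦄, 4 ≤ m → (∀ m' : ℕ, m' < m → ∀ ⦃X : SchemeOver ℂ⦄, IsSmoothProjective (2 * m') X →
        ∀ c : complexBetti X (2 * m'), IsRationalClass c → IsOfHodgeType (2 * m') X (2 * m') m' m' c →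
          c ∈ algebraicClasses X m') →
      ∀ ⦃X : SchemeOver ℂ⦄ (f : X ⟶ projectiveSpace 2 ℂ), IsSmoothProjective (2 * m) X →
        Function.Surjective f.left.base →
        Submodule.span ℂ {c : complexBetti X (2 * m) | IsRationalClass c ∧ IsOfHodgeType (2 * m) X (2 * m) m m c} ≤
          algebraicClasses X m ⊔ Submodule.span ℂ {c : complexBetti X (2 * m) | IsRationalClass c ∧
            IsOfHodgeType (2 * m) X (2 * m) m m c ∧ ∃ T : Set (projectiveSpace 2 ℂ).left, IsClosed T ∧
              T ≠ Set.univ ∧ complexBetti.restrictCompl X (f.left.base ⁻¹' T) (2 * m) c = 0} := by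
  intro m hm ih X f hX _
  -- level 2 of the ladder hypothesis is HC(4;2,2)
  have h42 : ∀ ⦃X : SchemeOver ℂ⦄, IsSmoothProjective 4 X → ∀ c : complexBetti X (2 * 2),
      IsRationalClass c → IsOfHodgeType 4 X (2 * 2) 2 2 c → c ∈ algebraicClasses X 2 :=
    fun X hX c hc hpp ↦ ih 2 (by omega) hX c hc hpp
  refine le_sup_of_le_left (Submodule.span_le.mpr ?_)
  rintro c ⟨hc, hpp⟩
  exact (hS h42 hX).2 m c hc hpp

/-- **The net × regime cut is LOSSLESS**: the crux `SummitGrantedFourfolds` is equivalent to the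
conjunction of its two NET pieces `P1 = SixfoldNetClasses` and `P2 = HigherNetClasses` (the vertical
piece being the theorem `higherVerticalClasses`). What remains open of the crux is exactly `P1 ∧ P2`:
the Hodge conjecture in the middle degree of `2m`-folds, `m ≥ 3`, modulo classes supported on a divisor
`f⁻¹T` of a net, in ladder form. [cite: BrosnanFangNiePearlstein2009, §6 Lemma 48] [cite: Deligne2000, §1] -/
theorem summitGrantedFourfolds_iff_netClasses :
    Summit.HodgeConjecture.HodgeConjecture.Theses.NoetherLefschetzOneUp.SummitGrantedFourfolds ↔
      ((∀ ⦃X : SchemeOver ℂ⦄, IsSmoothProjective 4 X → ∀ c : complexBetti X (2 * 2),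
          IsRationalClass c → IsOfHodgeType 4 X (2 * 2) 2 2 c → c ∈ algebraicClasses X 2) →
        ∀ ⦃X : SchemeOver ℂ⦄ (f : X ⟶ projectiveSpace 2 ℂ), IsSmoothProjective 6 X →
          Function.Surjective f.left.base →
          Submodule.span ℂ {c : complexBetti X (2 * 3) | IsRationalClass c ∧ IsOfHodgeType 6 X (2 * 3) 3 3 c} ≤
            algebraicClasses X 3 ⊔ Submodule.span ℂ {c : complexBetti X (2 * 3) | IsRationalClass c ∧
              IsOfHodgeType 6 X (2 * 3) 3 3 c ∧ ∃ T : Set (projectiveSpace 2 ℂ).left, IsClosed T ∧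
                T ≠ Set.univ ∧ complexBetti.restrictCompl X (f.left.base ⁻¹' T) (2 * 3) c = 0}) ∧
      (∀ ⦃m : ℕ⦄, 4 ≤ m → (∀ m' : ℕ, m' < m → ∀ ⦃X : SchemeOver ℂ⦄, IsSmoothProjective (2 * m') X →
          ∀ c : complexBetti X (2 * m'), IsRationalClass c → IsOfHodgeType (2 * m') X (2 * m') m' m' c →
            c ∈ algebraicClasses X m') →
        ∀ ⦃X : SchemeOver ℂ⦄ (f : X ⟶ projectiveSpace 2 ℂ), IsSmoothProjective (2 * m) X →
          Function.Surjective f.left.base →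
          Submodule.span ℂ {c : complexBetti X (2 * m) | IsRationalClass c ∧ IsOfHodgeType (2 * m) X (2 * m) m m c} ≤
            algebraicClasses X m ⊔ Submodule.span ℂ {c : complexBetti X (2 * m) | IsRationalClass c ∧
              IsOfHodgeType (2 * m) X (2 * m) m m c ∧ ∃ T : Set (projectiveSpace 2 ℂ).left, IsClosed T ∧
                T ≠ Set.univ ∧ complexBetti.restrictCompl X (f.left.base ⁻¹' T) (2 * m) c = 0}) :=
  ⟨fun hS ↦ ⟨sixfoldNetClasses_of_summitGrantedFourfolds hS, higherNetClasses_of_summitGrantedFourfolds hS⟩,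
    fun h ↦ summitGrantedFourfolds_of_netClasses h.1 h.2⟩

/-! ### The registered birth stubs from the net pieces alone

The REGISTERED birth skeleton (`Cruxes/SummitGrantedFourfolds/Lines/birth.lean` before the reshape,
sha a8ff086b…) cut the crux along the dimension ladder only: `stub_sixfoldsGrantedFourfolds` (rung 3
granted rung 2) and `stub_ladderFromEightfolds` (rungs `≥ 4` granted all rungs below). With the
vertical piece proved, each follows from the corresponding NET piece alone. -/

/-- **Rung 3 from the sixfold net piece**: `P1 = SixfoldNetClasses` implies
`HC(4;2,2) → every rational (3,3)-class on every smooth projective complex sixfold is algebraic` (the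
registered `stub_sixfoldsGrantedFourfolds`): the lower levels `0, 1, 2` are `algebraicClasses_zero`,
Lefschetz `(1,1)` and the hypothesis; a net of fourfolds over `ℙ²` on the sixfold, `P1` and
`higherVerticalClasses` on its total space, birational descent.
[cite: BrosnanFangNiePearlstein2009, §6 Lemma 48] [cite: Arapura2022, §1] -/
theorem sixfoldsGrantedFourfolds_of_sixfoldNetClasses
    (h6 : (∀ ⦃X : SchemeOver ℂ⦄, IsSmoothProjective 4 X → ∀ c : complexBetti X (2 * 2),
        IsRationalClass c → IsOfHodgeType 4 X (2 * 2) 2 2 c → c ∈ algebraicClasses X 2) →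
      ∀ ⦃X : SchemeOver ℂ⦄ (f : X ⟶ projectiveSpace 2 ℂ), IsSmoothProjective 6 X →
        Function.Surjective f.left.base →
        Submodule.span ℂ {c : complexBetti X (2 * 3) | IsRationalClass c ∧ IsOfHodgeType 6 X (2 * 3) 3 3 c} ≤
          algebraicClasses X 3 ⊔ Submodule.span ℂ {c : complexBetti X (2 * 3) | IsRationalClass c ∧
            IsOfHodgeType 6 X (2 * 3) 3 3 c ∧ ∃ T : Set (projectiveSpace 2 ℂ).left, IsClosed T ∧
              T ≠ Set.univ ∧ complexBetti.restrictCompl X (f.left.base ⁻¹' T) (2 * 3) c = 0}) :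
    (∀ ⦃X : SchemeOver ℂ⦄, IsSmoothProjective 4 X → ∀ c : complexBetti X (2 * 2),
      IsRationalClass c → IsOfHodgeType 4 X (2 * 2) 2 2 c → c ∈ algebraicClasses X 2) →
    ∀ ⦃X : SchemeOver ℂ⦄, IsSmoothProjective 6 X → ∀ c : complexBetti X (2 * 3),
      IsRationalClass c → IsOfHodgeType 6 X (2 * 3) 3 3 c → c ∈ algebraicClasses X 3 := by
  intro h42 Y hY c hc hpp
  -- the lower levels 0, 1, 2 (theorems + the hypothesis)
  have ih : ∀ m' : ℕ, m' < 3 → ∀ ⦃X : SchemeOver ℂ⦄, IsSmoothProjective (2 * m') X →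
      ∀ c : complexBetti X (2 * m'), IsRationalClass c →
        IsOfHodgeType (2 * m') X (2 * m') m' m' c → c ∈ algebraicClasses X m' := by
    intro m' hm'
    interval_cases m'
    · intro X _ c _ _
      rw [algebraicClasses_zero]
      exact Submodule.mem_top
    · exact fun X hX c hc hpp ↦ LefschetzOneOne_holds hX c hc hpp
    · exact fun X hX c hc hpp ↦ h42 hX c hc hpp
  -- a net of fourfolds over ℙ² on the sixfold, the two pieces on its total space, birational descent
  have hY' : IsSmoothProjective (2 + 2 * 2) Y := hY
  obtain ⟨N, -⟩ := exists_fiberNet_smoothBase_nonempty_holds (2 * 2) 2 (by omega) hY'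
  have htot : IsSmoothProjective (2 * 3) N.total := N.isSmoothProjective_total
  refine mem_algebraicClasses_of_isBirational htot hY N.blowDown (isBirational_blowDown hY' N) ?_ c hc hpp
  intro c' hc' hpp'
  have hv := higherVerticalClasses (show 3 ≤ 3 from le_rfl) ih N.proj htot (FiberNet.surjective_proj N)
  have h1 := h6 h42 N.proj htot (FiberNet.surjective_proj N)
  exact (sup_le le_rfl hv) (h1 (Submodule.subset_span ⟨hc', hpp'⟩))

/-- **Rungs `≥ 4` from the higher net piece**: `P2 = HigherNetClasses` implies, for every `m ≥ 4`,
the middle degree of all smooth projective `2m`-folds granted all lower levels (the registered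
`stub_ladderFromEightfolds`): a net of `(2m-2)`-folds over `ℙ²`, `P2` and `higherVerticalClasses` on
its total space, birational descent. [cite: BrosnanFangNiePearlstein2009, §6 Lemma 48] [cite: Arapura2022, §1] -/
theorem ladderFromEightfolds_of_higherNetClasses
    (hN : ∀ ⦃m : ℕ⦄, 4 ≤ m → (∀ m' : ℕ, m' < m → ∀ ⦃X : SchemeOver ℂ⦄, IsSmoothProjective (2 * m') X →
        ∀ c : complexBetti X (2 * m'), IsRationalClass c → IsOfHodgeType (2 * m') X (2 * m') m' m' c →
          c ∈ algebraicClasses X m') →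
      ∀ ⦃X : SchemeOver ℂ⦄ (f : X ⟶ projectiveSpace 2 ℂ), IsSmoothProjective (2 * m) X →
        Function.Surjective f.left.base →
        Submodule.span ℂ {c : complexBetti X (2 * m) | IsRationalClass c ∧ IsOfHodgeType (2 * m) X (2 * m) m m c} ≤
          algebraicClasses X m ⊔ Submodule.span ℂ {c : complexBetti X (2 * m) | IsRationalClass c ∧
            IsOfHodgeType (2 * m) X (2 * m) m m c ∧ ∃ T : Set (projectiveSpace 2 ℂ).left, IsClosed T ∧
              T ≠ Set.univ ∧ complexBetti.restrictCompl X (f.left.base ⁻¹' T) (2 * m) c = 0}) :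
    ∀ m : ℕ, 4 ≤ m →
      (∀ m' : ℕ, m' < m → ∀ ⦃X : SchemeOver ℂ⦄, IsSmoothProjective (2 * m') X →
        ∀ c : complexBetti X (2 * m'), IsRationalClass c →
          IsOfHodgeType (2 * m') X (2 * m') m' m' c → c ∈ algebraicClasses X m') →
      ∀ ⦃X : SchemeOver ℂ⦄, IsSmoothProjective (2 * m) X → ∀ c : complexBetti X (2 * m),
        IsRationalClass c → IsOfHodgeType (2 * m) X (2 * m) m m c → c ∈ algebraicClasses X m := by
  intro m hm ih Y hY c hc hpp
  obtain ⟨k, rfl⟩ : ∃ k, m = k + 1 := ⟨m - 1, by omega⟩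
  have e : 2 + 2 * k = 2 * (k + 1) := by ring
  have hY' : IsSmoothProjective (2 + 2 * k) Y := e ▸ hY
  obtain ⟨N, -⟩ := exists_fiberNet_smoothBase_nonempty_holds (2 * k) 2 (by omega) hY'
  have htot : IsSmoothProjective (2 * (k + 1)) N.total := e ▸ N.isSmoothProjective_total
  refine mem_algebraicClasses_of_isBirational htot hY N.blowDown (isBirational_blowDown hY' N) ?_ c hc hpp
  intro c' hc' hpp'
  have hv := higherVerticalClasses (show 3 ≤ k + 1 by omega) ih N.proj htot (FiberNet.surjective_proj N)
  have h1 := hN hm ih N.proj htot (FiberNet.surjective_proj N)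
  exact (sup_le le_rfl hv) (h1 (Submodule.subset_span ⟨hc', hpp'⟩))

end Summit.HodgeConjecture.HodgeConjecture.Theorems

end
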